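import Summits.AtomisticToContinuum.BoseEinsteinCondensation.Theorems.BECGroundStateSOSPeriodicIRBoundTwoSectorKLSTPair
import Summits.AtomisticToContinuum.BoseEinsteinCondensation.Theorems.BECGroundStateSOSPeriodicIRBoundTwoSectorWindowTPair
import Summits.AtomisticToContinuum.BoseEinsteinCondensation.Theorems.BECGroundStateSOSPeriodicIRBoundTwoSectorExchangeBound
import Summits.AtomisticToContinuum.BoseEinsteinCondensation.Theorems.BECGroundStateSOSPeriodicIRBoundTwoSectorPotCosLower
import Summits.AtomisticToContinuum.BoseEinsteinCondensation.Theorems.BECGroundStateSOSPeriodicIRBoundTwoSectorFsumLower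
import Summits.AtomisticToContinuum.BoseEinsteinCondensation.Theorems.BECGroundStateSOSPeriodicIRBoundTwoSectorCondensateFraction
import Summits.AtomisticToContinuum.BoseEinsteinCondensation.Theorems.BECGroundStateSOSPeriodicIRBoundTwoSectorPairSharesReal
import Summits.AtomisticToContinuum.BoseEinsteinCondensation.Theorems.BECGroundStateSOSPeriodicIRBoundTwoSectorEffectiveGap
import Summits.AtomisticToContinuum.BoseEinsteinCondensation.Theorems.BECGroundStateSOSPeriodicIRBoundTwoSectorSoftLocation
import Summits.AtomisticToContinuum.BoseEinsteinCondensation.Theorems.BECGroundStateSOSPeriodicIRBoundTwoSectorLowReduction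
import HarnessLib

/-!
# Route `BECGroundStateSOS`, crux `PeriodicIRBound` (stmt-AtomisticToContinuum-3972), line `two-sector-gd-transfer` (v12) —
# THE EQUIVALENCE: the line's residual is exactly the integrable half of the crux

Supports (does not close) stmt-AtomisticToContinuum-3972. Lead seat c23 (`Cruxes/PeriodicIRBound/SOFT-LOCATION.md`). With the
nine provable v11 stubs landed — S4₁ `stub_klsNearMinimiserPair` (p162986), S5₁ `stub_windowAssemblyPair` (p162927), S11a
`stub_exchangeCondensateBound` (p164262), S11e `stub_potCosLowerBound`, S11b `stub_fsumLowerBound` (p163185), S11c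
`stub_condensateFractionOfIR` (p163320), S11d₁ `stub_pairSharesReal` (p162704), S11d₂ₐ `stub_effectiveGapOf` (p163317),
S11d₂ᵦ `stub_softLocationOfGap` (p163313) — the glue `floatingPairTwoChannel_iff_integrableHalf` of the v11 Defs module
(p162131) becomes UNCONDITIONAL:

* `stub_floatingPairIffIntegrableHalf` — S1₁ `FloatingPairTwoChannel` (the per-state floating two-channel
  Kennedy–Lieb–Shastry bound on the exact-momentum test vectors `a†(φ_n)Ψ`, `a(φ_n)Ψ` of momentum-zero near-minimisers,
  low window, relaxed guard) **⟺** `∀ v` integrable admissible, `IRBoundFor v` (the integrable half of `PeriodicIRBound`);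
* `stub_periodicIRBoundIffPair` — **`PeriodicIRBound ⟺ FloatingPairTwoChannel ∧ NonIntegrableHalf`**;
* `stub_periodicIRBoundOfFloatingPair` — the sixth standing reduction, S1₁ ∧ S6 ⇒ crux by name;
* the recorded funnel: `12620 ∧ 9094 ⇒ S1' ⇒ S1₀ ⇒ S1₁`, `C⁺ ⇒ S1₀ ⇒ S1₁` (`floatingPairTwoChannel_of_linearParticleHoleFloor`).

Reading for planners and mechanism seats: the two-sector / floating-threshold architecture is a CERTIFIED EQUIVALENT
REFORMULATION of X_int, not a reduction of it — nothing weaker than X_int remains inside this line, and S1₁ is the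
structured normal form in which X_int can be attacked (per mode: a first-moment Landau floor in each KLS channel, common
chemical potential floating per state). The honest split of the crux is `X_int ∧ X_hc` (`Negative.periodicIRBound_iff_split`).
Nothing is cited as a fact; every input is a landed theorem of the line.
-/

noncomputable section

open scoped BigOperators ENNReal
open Filter MeasureTheory

namespace Summit.AtomisticToContinuum.BoseEinsteinCondensation.Cruxes.PeriodicIRBound.TwoSectorGdTransfer

open Literature.MathematicalPhysics.QuantumManyBody.BoseGas
open Summit.AtomisticToContinuum.BoseEinsteinCondensation.Theses.BECGroundStateSOS (PeriodicIRBound)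
open Summit.AtomisticToContinuum.BoseEinsteinCondensation.Theses.BECTwoSectorGD (GaussianDomination)
open Summit.AtomisticToContinuum.BoseEinsteinCondensation.Theses.BECSectorPoincareTwoScale (EnergyConvexityWindow)
open Summit.AtomisticToContinuum.BoseEinsteinCondensation.Theorems.PeriodicIRBound.Negative
  (IRBoundFor periodicIRBound_iff_split)
open Summit.AtomisticToContinuum.BoseEinsteinCondensation.Cruxes.PeriodicIRBound.LinearPhFloorWagner
  (LinearParticleHoleFloor)

/-- **The soft-location arrow is a theorem**: S11d₂ `SoftLocationOf` from the landed S11d₂ₐ and S11d₂ᵦ. [folklore] -/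
theorem softLocationOf_holds : SoftLocationOf :=
  softLocationOf_of_split stub_effectiveGapOf stub_softLocationOfGap

/-- **X_int ⇒ S1₁, unconditionally**: the integrable half of the crux implies the per-state floating two-channel bound
(SOFT-LOCATION.md; landed S11a, S11e, S11b, S11c, S11d₁, S11d₂, S9'). [folklore] -/
theorem floatingPairTwoChannel_of_integrableHalf
    (hX : ∀ v : ℝ → ℝ≥0∞, IsRepulsiveFiniteRange v → (∫⁻ x : Space, v ‖x‖) ≠ ⊤ → IRBoundFor v) :
    FloatingPairTwoChannel :=
  floatingPair_of_integrableHalf stub_exchangeCondensateBound stub_potCosLowerBound stub_fsumLowerBound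
    stub_condensateFractionOfIR stub_pairSharesReal softLocationOf_holds hX

/-- **S1₁ ⇒ X_int, unconditionally** (landed S4₁, S5₁, normal form p156444). [folklore] -/
theorem integrableHalf_of_floatingPairTwoChannel (h1 : FloatingPairTwoChannel) :
    ∀ v : ℝ → ℝ≥0∞, IsRepulsiveFiniteRange v → (∫⁻ x : Space, v ‖x‖) ≠ ⊤ → IRBoundFor v :=
  integrableHalf_of_floatingPair h1 stub_klsNearMinimiserPair stub_windowAssemblyPair

/-- **Registered by-product `stub_floatingPairIffIntegrableHalf` — THE EQUIVALENCE (sorry-free)**: the v11 load S1₁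
`FloatingPairTwoChannel` holds if and only if the crux's infrared inequality holds for every integrable admissible potential.
[folklore] -/
theorem stub_floatingPairIffIntegrableHalf :
    FloatingPairTwoChannel ↔
      ∀ v : ℝ → ℝ≥0∞, IsRepulsiveFiniteRange v → (∫⁻ x : Space, v ‖x‖) ≠ ⊤ → IRBoundFor v :=
  ⟨integrableHalf_of_floatingPairTwoChannel, floatingPairTwoChannel_of_integrableHalf⟩

/-- **Registered by-product `stub_periodicIRBoundOfFloatingPair`** — the sixth standing reduction of the crux: S1₁ and the
scope half S6 give `PeriodicIRBound` by name. [folklore] -/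
theorem stub_periodicIRBoundOfFloatingPair : FloatingPairTwoChannel → NonIntegrableHalf → PeriodicIRBound :=
  fun h1 h6 => periodicIRBound_iff_split.2 ⟨integrableHalf_of_floatingPairTwoChannel h1, h6⟩

/-- **Registered by-product `stub_periodicIRBoundIffPair` — the crux is EQUIVALENT to S1₁ ∧ S6.** [folklore] -/
theorem stub_periodicIRBoundIffPair : PeriodicIRBound ↔ FloatingPairTwoChannel ∧ NonIntegrableHalf := by
  rw [periodicIRBound_iff_split]
  exact ⟨fun h => ⟨floatingPairTwoChannel_of_integrableHalf h.1, h.2⟩,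
    fun h => ⟨integrableHalf_of_floatingPairTwoChannel h.1, h.2⟩⟩

/-- **The funnel, completed**: line 1's residual `C⁺ = LinearParticleHoleFloor` implies S1₁ (through the landed
`C⁺ ⇒ S1₀`, p161258). [folklore] -/
theorem floatingPairTwoChannel_of_linearParticleHoleFloor (hC : LinearParticleHoleFloor) : FloatingPairTwoChannel :=
  floatingPairTwoChannel_of_floatingTwoChannelLow (stub_floatingLowOfLinearParticleHoleFloor hC)

/-- stmt-12620 ∧ stmt-9094 imply S1₁ (through S1' and S1₀). [folklore] -/
theorem floatingPairTwoChannel_of_pooled (hGD : GaussianDomination) (hC : EnergyConvexityWindow) :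
    FloatingPairTwoChannel :=
  floatingPairTwoChannel_of_floatingTwoChannelLow (floatingTwoChannelLow_of_pooled hGD hC)

end Summit.AtomisticToContinuum.BoseEinsteinCondensation.Cruxes.PeriodicIRBound.TwoSectorGdTransfer

end
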